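import Summits.AtomisticToContinuum.FouriersLaw.Theorems.OddSectorIrreversibilityGreenKuboWindowSqIntegrable

/-!
# The Kubo-corrector pairing equals the Green–Kubo integral (support for stmt-AtomisticToContinuum-10924)

Fixed-`N` bookkeeping for route `OddSectorIrreversibility` (sub-problem `FouriersLaw`), first step
of `WitnessGlue` on the way to the shared item `BoundedResponse`:
"`⟨u, J⟩_π = ∫₀^∞ c_N` (CorrectorTheory B + A(4) + Fubini)". For `pinnedChain ω₂ lam β γ`
(`ω₂ > 0`, `lam ≥ 0`, `β, γ > 0`), `N ≥ 1`, `T > 0`, the total current `J = ∑_i j_i`, the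
equilibrium kernels `P_t = transitionKernel N T T t`, the Gibbs measure `π = gibbsMeasure N T`, the
unnormalised Gibbs weight `μ_T = e^{-H/T} dq dp` (mass `Z = ∫ e^{-H/T}`; `μ_T = Z · π`) and ANY
function `u` with

* `u ∈ L²(μ_T)` (conjunct A(2) of `CorrectorTheory`) and
* `∫ (u_τ - u)² dμ_T → 0` as `τ → ∞`, `u_τ = ∫_{(0,τ]} P_t J dt` (conjunct A(4)),

and provided `c_N(t) = ∫ J · P_tJ dπ` is integrable on `(0, ∞)` (conjunct B, first half):

* `pinnedChain_withDensity_eq_smul_gibbsMeasure` — `μ_T = Z • π` (`Z = partitionFunction N T`);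
* `pinnedChain_tendsto_integral_windowedCorrector_mul` — `∫ u_τ J dπ → ∫ u J dπ`
  (weighted Cauchy–Schwarz; the squares `(u_τ - u)²` ARE integrable, by
  `pinnedChain_sq_windowedCorrector_le`, so A(4) is an honest `L²` statement);
* `pinnedChain_integral_corrector_mul_gibbsMeasure` — `∫ u J dπ = ∫_{(0,∞)} c_N`;
* `pinnedChain_integral_corrector_mul_withDensity` — **`∫ u J dμ_T = Z ∫_{(0,∞)} c_N`** with
  `Z = ∫ e^{-H/T} dq dp`, in the exact vocabulary of `CorrectorTheory` (so that, with conjunct B,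
  `⟨u, J⟩_{μ_T} = Z (N-1) T² D_N`).

No definitions, no named facts; nothing here closes an item.
-/

noncomputable section

open MeasureTheory ProbabilityTheory Filter Topology Set
open scoped NNReal ENNReal

namespace Summit.AtomisticToContinuum.FouriersLaw.Theorems

open Literature.MathematicalPhysics.KineticTheory.HeatConduction
open Literature.MathematicalPhysics.KineticTheory Literature.Probability.Process OscillatorChain
open Summit.AtomisticToContinuum.FouriersLaw.Theorems.SubdiffusiveBondHeat

section Pairing

variable {ω₂ lam β γ : ℝ} (hω : 0 < ω₂) (hl : 0 ≤ lam) (hβ : 0 < β) (hγ : 0 < γ) {N : ℕ} (hN : 0 <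
      N)
  {T : ℝ} (hT : 0 < T)


include hω hl hβ hT

omit hβ in
/-- **`μ_T = Z • π`**: the unnormalised Gibbs weight of `CorrectorTheory` is the partition function
times the Gibbs probability measure (`gibbsMeasure_eq_smul_withDensity`, `0 < Z < ∞`). [folklore] -/
theorem pinnedChain_withDensity_eq_smul_gibbsMeasure (hβ' : 0 ≤ β) :
    (volume.withDensity (fun x : PhaseSpace N => ENNReal.ofReal (Real.exp (-((pinnedChain ω₂ lam β
          γ).hamiltonian N x) / T)))) = (pinnedChain ω₂ lam β γ).partitionFunction N T •
          ((pinnedChain ω₂ lam β γ).gibbsMeasure N T) := by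
  have hint : Integrable ((pinnedChain ω₂ lam β γ).gibbsDensity N T) :=
    pinnedChain_integrable_gibbsDensity hω hl hβ' γ N hT
  have hZ0 : (pinnedChain ω₂ lam β γ).partitionFunction N T ≠ 0 :=
    (pinnedChain ω₂ lam β γ).partitionFunction_ne_zero (pinnedChain_continuous_gibbsDensity ω₂ lam β
          γ N T)
  have hZt : (pinnedChain ω₂ lam β γ).partitionFunction N T ≠ ⊤ :=
    (pinnedChain ω₂ lam β γ).partitionFunction_ne_top hint
  have e : (fun x : PhaseSpace N => ENNReal.ofReal (Real.exp (-((pinnedChain ω₂ lam β γ).hamiltonian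
        N x) / T))) =
      fun x => ENNReal.ofReal ((pinnedChain ω₂ lam β γ).gibbsDensity N T x) := rfl
  rw [e, (pinnedChain ω₂ lam β γ).gibbsMeasure_eq_smul_withDensity hint, smul_smul,
    ENNReal.mul_inv_cancel hZ0 hZt, one_smul]

include hγ hN

/-- **`∫ u_τ J dπ → ∫ u J dπ`** along `τ → ∞` for every `u ∈ L²(π)` with `∫ (u_τ - u)² dπ → 0`
(the squares are integrable by `pinnedChain_sq_windowedCorrector_le`, so this is honest `L²(π)`
convergence; weighted Cauchy–Schwarz against `J ∈ L²(π)`). [folklore] -/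
theorem pinnedChain_tendsto_integral_windowedCorrector_mul {u : PhaseSpace N → ℝ}
    (hu2 : MemLp u 2 ((pinnedChain ω₂ lam β γ).gibbsMeasure N T))
    (h4 : Tendsto (fun τ : ℝ => ∫ x, ((∫ t in Ioc 0 τ, (∫ y, (∑ i : Fin N, (pinnedChain ω₂ lam β
          γ).bondCurrent N i y) ∂((pinnedChain ω₂ lam β γ).transitionKernel N T T (Real.toNNReal t)
          x))) - u x) ^ 2 ∂((pinnedChain ω₂ lam β γ).gibbsMeasure N T)) atTop (𝓝 0)) :
    Integrable (fun x => u x * (∑ i : Fin N, (pinnedChain ω₂ lam β γ).bondCurrent N i x))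
          ((pinnedChain ω₂ lam β γ).gibbsMeasure N T) ∧
      Tendsto (fun τ : ℝ => ∫ x, (∫ t in Ioc 0 τ, (∫ y, (∑ i : Fin N, (pinnedChain ω₂ lam β
            γ).bondCurrent N i y) ∂((pinnedChain ω₂ lam β γ).transitionKernel N T T (Real.toNNReal
            t) x))) * (∑ i : Fin N, (pinnedChain ω₂ lam β γ).bondCurrent N i x) ∂((pinnedChain ω₂
            lam β γ).gibbsMeasure N T)) atTop
        (𝓝 (∫ x, u x * (∑ i : Fin N, (pinnedChain ω₂ lam β γ).bondCurrent N i x) ∂((pinnedChain ω₂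
              lam β γ).gibbsMeasure N T))) := by
  haveI : IsProbabilityMeasure ((pinnedChain ω₂ lam β γ).gibbsMeasure N T) :=
        pinnedChain_isProbabilityMeasure_gibbsMeasure hω hl hβ.le γ N hT
  have hJc : Continuous fun z : PhaseSpace N => (∑ i : Fin N, (pinnedChain ω₂ lam β γ).bondCurrent N
        i z) := pinnedChain_continuous_sum_bondCurrent
  have hJ2 : Integrable (fun z => (∑ i : Fin N, (pinnedChain ω₂ lam β γ).bondCurrent N i z) ^ 2)
        ((pinnedChain ω₂ lam β γ).gibbsMeasure N T) :=
    (pinnedChain_sq_act_sum_bondCurrent hω hl hβ hγ hN hT 0).1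
  have hu2' : Integrable (fun x => u x ^ 2) ((pinnedChain ω₂ lam β γ).gibbsMeasure N T) :=
        hu2.integrable_sq
  have hum : AEStronglyMeasurable u ((pinnedChain ω₂ lam β γ).gibbsMeasure N T) := hu2.1
  -- `u J ∈ L¹(π)` by AM–GM domination
  have huJ : Integrable (fun x => u x * (∑ i : Fin N, (pinnedChain ω₂ lam β γ).bondCurrent N i x))
        ((pinnedChain ω₂ lam β γ).gibbsMeasure N T) := by
    have hdom : Integrable (fun x => (u x ^ 2 + (∑ i : Fin N, (pinnedChain ω₂ lam β γ).bondCurrent N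
          i x) ^ 2) / 2) ((pinnedChain ω₂ lam β γ).gibbsMeasure N T) := (hu2'.add hJ2).div_const 2
    refine hdom.mono' (hum.mul hJc.aestronglyMeasurable) (Eventually.of_forall fun x => ?_)
    rw [Real.norm_eq_abs, abs_mul]
    nlinarith [sq_nonneg (|u x| - |(∑ i : Fin N, (pinnedChain ω₂ lam β γ).bondCurrent N i x)|),
          sq_abs (u x), sq_abs ((∑ i : Fin N, (pinnedChain ω₂ lam β γ).bondCurrent N i x))]
  refine ⟨huJ, ?_⟩
  -- windowed pairing minus limit pairing = pairing of the `L²`-small difference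
  have hPJm : StronglyMeasurable fun p : PhaseSpace N × ℝ => (∫ y, (∑ i : Fin N, (pinnedChain ω₂ lam
        β γ).bondCurrent N i y) ∂((pinnedChain ω₂ lam β γ).transitionKernel N T T (Real.toNNReal
        p.2) p.1)) :=
    pinnedChain_stronglyMeasurable_act_sum_bondCurrent hω hl hβ hγ
  have hUm : ∀ τ : ℝ, AEStronglyMeasurable (fun x => ∫ t in Ioc 0 τ, (∫ y, (∑ i : Fin N,
        (pinnedChain ω₂ lam β γ).bondCurrent N i y) ∂((pinnedChain ω₂ lam β γ).transitionKernel N T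
        T (Real.toNNReal t) x))) ((pinnedChain ω₂ lam β γ).gibbsMeasure N T) := fun τ =>
    (hPJm.integral_prod_right' (ν := volume.restrict (Ioc (0 : ℝ) τ))).aestronglyMeasurable
  have hdiff2 : ∀ τ : ℝ, 0 ≤ τ →
      Integrable (fun x => ((∫ t in Ioc 0 τ, (∫ y, (∑ i : Fin N, (pinnedChain ω₂ lam β
            γ).bondCurrent N i y) ∂((pinnedChain ω₂ lam β γ).transitionKernel N T T (Real.toNNReal
            t) x))) - u x) ^ 2) ((pinnedChain ω₂ lam β γ).gibbsMeasure N T) := by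
    intro τ hτ
    have hU2 := (pinnedChain_sq_windowedCorrector_le hω hl hβ hγ hN hT hτ).1
    have hdom : Integrable (fun x => 2 * (∫ t in Ioc 0 τ, (∫ y, (∑ i : Fin N, (pinnedChain ω₂ lam β
          γ).bondCurrent N i y) ∂((pinnedChain ω₂ lam β γ).transitionKernel N T T (Real.toNNReal t)
          x))) ^ 2 + 2 * u x ^ 2) ((pinnedChain ω₂ lam β γ).gibbsMeasure N T) :=
      (hU2.const_mul 2).add (hu2'.const_mul 2)
    refine hdom.mono' (((hUm τ).sub hum).pow 2) (Eventually.of_forall fun x => ?_)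
    rw [Real.norm_of_nonneg (sq_nonneg _)]
    nlinarith [sq_nonneg ((∫ t in Ioc 0 τ, (∫ y, (∑ i : Fin N, (pinnedChain ω₂ lam β γ).bondCurrent
          N i y) ∂((pinnedChain ω₂ lam β γ).transitionKernel N T T (Real.toNNReal t) x))) + u x)]
  have hUJ : ∀ τ : ℝ, Integrable (fun x => (∫ t in Ioc 0 τ, (∫ y, (∑ i : Fin N, (pinnedChain ω₂ lam
        β γ).bondCurrent N i y) ∂((pinnedChain ω₂ lam β γ).transitionKernel N T T (Real.toNNReal t)
        x))) * (∑ i : Fin N, (pinnedChain ω₂ lam β γ).bondCurrent N i x)) ((pinnedChain ω₂ lam β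
        γ).gibbsMeasure N T) := fun τ =>
    (pinnedChain_integral_windowedCorrector_mul hω hl hβ hγ hN hT τ).1
  have hsplit : ∀ τ : ℝ, (∫ x, (∫ t in Ioc 0 τ, (∫ y, (∑ i : Fin N, (pinnedChain ω₂ lam β
        γ).bondCurrent N i y) ∂((pinnedChain ω₂ lam β γ).transitionKernel N T T (Real.toNNReal t)
        x))) * (∑ i : Fin N, (pinnedChain ω₂ lam β γ).bondCurrent N i x) ∂((pinnedChain ω₂ lam β
        γ).gibbsMeasure N T)) - ∫ x, u x * (∑ i : Fin N, (pinnedChain ω₂ lam β γ).bondCurrent N i x)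
        ∂((pinnedChain ω₂ lam β γ).gibbsMeasure N T) =
      ∫ x, ((∫ t in Ioc 0 τ, (∫ y, (∑ i : Fin N, (pinnedChain ω₂ lam β γ).bondCurrent N i y)
            ∂((pinnedChain ω₂ lam β γ).transitionKernel N T T (Real.toNNReal t) x))) - u x) * (∑ i :
            Fin N, (pinnedChain ω₂ lam β γ).bondCurrent N i x) ∂((pinnedChain ω₂ lam β
            γ).gibbsMeasure N T) := by
    intro τ
    rw [← integral_sub (hUJ τ) huJ]
    refine integral_congr_ae (Eventually.of_forall fun x => ?_)
    ring
  -- ε-argument with the weighted Cauchy–Schwarz `|∫ab| ≤ (ε∫a² + ε⁻¹∫b²)/2`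
  rw [Metric.tendsto_atTop]
  intro ε hε
  set A : ℝ := ∫ z, (∑ i : Fin N, (pinnedChain ω₂ lam β γ).bondCurrent N i z) ^ 2 ∂((pinnedChain ω₂
        lam β γ).gibbsMeasure N T) with hA
  have hA0 : 0 ≤ A := integral_nonneg fun z => sq_nonneg _
  -- weight `w` with `w A / 2 < ε / 2`
  set w : ℝ := ε / (2 * (A + 1)) with hw
  have hw0 : 0 < w := by positivity
  have hwA : w * A / 2 < ε / 2 := by
    have h1 : w * A ≤ w * (A + 1) := by nlinarith
    have h2 : w * (A + 1) = ε / 2 := by rw [hw]; field_simp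
    nlinarith
  -- `τ₀` with `∫ (u_τ - u)² < w ε / 2` (hence `w⁻¹ ∫ (u_τ - u)² / 2 < ε / 4`) beyond it
  have hsmall : ∀ᶠ τ : ℝ in atTop, ∫ x, ((∫ t in Ioc 0 τ, (∫ y, (∑ i : Fin N, (pinnedChain ω₂ lam β
        γ).bondCurrent N i y) ∂((pinnedChain ω₂ lam β γ).transitionKernel N T T (Real.toNNReal t)
        x))) - u x) ^ 2 ∂((pinnedChain ω₂ lam β γ).gibbsMeasure N T) < w * ε / 2 :=
    (tendsto_order.1 h4).2 _ (by positivity)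
  obtain ⟨τ₀, hτ₀⟩ := (hsmall.and (eventually_ge_atTop 0)).exists_forall_of_atTop
  refine ⟨τ₀, fun τ hτ => ?_⟩
  obtain ⟨hsm, hτ0⟩ := hτ₀ τ hτ
  rw [Real.dist_eq, hsplit τ]
  have hcs := abs_integral_mul_le_weighted (hdiff2 τ hτ0) hJ2 (inv_pos.2 hw0)
  rw [inv_inv] at hcs
  -- `|∫ (u_τ-u) J| ≤ (w⁻¹ ∫(u_τ-u)² + w A)/2 < ε/4 + ε/2 < ε`
  have h3 : w⁻¹ * (∫ x, ((∫ t in Ioc 0 τ, (∫ y, (∑ i : Fin N, (pinnedChain ω₂ lam β γ).bondCurrent N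
        i y) ∂((pinnedChain ω₂ lam β γ).transitionKernel N T T (Real.toNNReal t) x))) - u x) ^ 2
        ∂((pinnedChain ω₂ lam β γ).gibbsMeasure N T)) < ε / 2 := by
    rw [inv_mul_lt_iff₀ hw0]
    linarith
  calc |∫ x, ((∫ t in Ioc 0 τ, (∫ y, (∑ i : Fin N, (pinnedChain ω₂ lam β γ).bondCurrent N i y)
        ∂((pinnedChain ω₂ lam β γ).transitionKernel N T T (Real.toNNReal t) x))) - u x) * (∑ i : Fin
        N, (pinnedChain ω₂ lam β γ).bondCurrent N i x) ∂((pinnedChain ω₂ lam β γ).gibbsMeasure N T)|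
      ≤ (w⁻¹ * (∫ x, ((∫ t in Ioc 0 τ, (∫ y, (∑ i : Fin N, (pinnedChain ω₂ lam β γ).bondCurrent N i
            y) ∂((pinnedChain ω₂ lam β γ).transitionKernel N T T (Real.toNNReal t) x))) - u x) ^ 2
            ∂((pinnedChain ω₂ lam β γ).gibbsMeasure N T)) + w * A) / 2 := by
        simpa [hA, mul_comm] using hcs
    _ < ε := by linarith

/-- **`⟨u, J⟩_π = ∫_{(0,∞)} c_N`**: for every `u ∈ L²(π)` with `∫ (u_τ - u)² dπ → 0`, if the
equilibrium current autocorrelation `c_N(t) = ∫ J · P_tJ dπ` is integrable on `(0, ∞)` then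
`∫ u J dπ = ∫_{(0,∞)} c_N(t) dt` (Fubini on each window, `pinnedChain_integral_windowedCorrector_mul`,
then `τ → ∞` on both sides and uniqueness of limits). [folklore] -/
theorem pinnedChain_integral_corrector_mul_gibbsMeasure {u : PhaseSpace N → ℝ}
    (hu2 : MemLp u 2 ((pinnedChain ω₂ lam β γ).gibbsMeasure N T))
    (h4 : Tendsto (fun τ : ℝ => ∫ x, ((∫ t in Ioc 0 τ, (∫ y, (∑ i : Fin N, (pinnedChain ω₂ lam β
          γ).bondCurrent N i y) ∂((pinnedChain ω₂ lam β γ).transitionKernel N T T (Real.toNNReal t)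
          x))) - u x) ^ 2 ∂((pinnedChain ω₂ lam β γ).gibbsMeasure N T)) atTop (𝓝 0))
    (hc : IntegrableOn (fun t : ℝ => ∫ z, (∑ i : Fin N, (pinnedChain ω₂ lam β γ).bondCurrent N i z)
          * (∫ y, (∑ i : Fin N, (pinnedChain ω₂ lam β γ).bondCurrent N i y) ∂((pinnedChain ω₂ lam β
          γ).transitionKernel N T T (Real.toNNReal t) z)) ∂((pinnedChain ω₂ lam β γ).gibbsMeasure N
          T)) (Ioi 0)) :
    ∫ x, u x * (∑ i : Fin N, (pinnedChain ω₂ lam β γ).bondCurrent N i x) ∂((pinnedChain ω₂ lam β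
          γ).gibbsMeasure N T) = ∫ t in Ioi 0, (∫ z, (∑ i : Fin N, (pinnedChain ω₂ lam β
          γ).bondCurrent N i z) * (∫ y, (∑ i : Fin N, (pinnedChain ω₂ lam β γ).bondCurrent N i y)
          ∂((pinnedChain ω₂ lam β γ).transitionKernel N T T (Real.toNNReal t) z)) ∂((pinnedChain ω₂
          lam β γ).gibbsMeasure N T)) := by
  have hlim1 := (pinnedChain_tendsto_integral_windowedCorrector_mul hω hl hβ hγ hN hT hu2 h4).2
  -- the windowed pairings are the windowed Green–Kubo integrals, which converge to the improper one
  have hlim2 : Tendsto (fun τ : ℝ => ∫ x, (∫ t in Ioc 0 τ, (∫ y, (∑ i : Fin N, (pinnedChain ω₂ lam β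
        γ).bondCurrent N i y) ∂((pinnedChain ω₂ lam β γ).transitionKernel N T T (Real.toNNReal t)
        x))) * (∑ i : Fin N, (pinnedChain ω₂ lam β γ).bondCurrent N i x) ∂((pinnedChain ω₂ lam β
        γ).gibbsMeasure N T)) atTop
      (𝓝 (∫ t in Ioi 0, (∫ z, (∑ i : Fin N, (pinnedChain ω₂ lam β γ).bondCurrent N i z) * (∫ y, (∑ i
            : Fin N, (pinnedChain ω₂ lam β γ).bondCurrent N i y) ∂((pinnedChain ω₂ lam β
            γ).transitionKernel N T T (Real.toNNReal t) z)) ∂((pinnedChain ω₂ lam β γ).gibbsMeasure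
            N T)))) := by
    have h := intervalIntegral_tendsto_integral_Ioi 0 hc tendsto_id
    refine h.congr' ?_
    filter_upwards [eventually_ge_atTop (0 : ℝ)] with τ hτ
    rw [id, intervalIntegral.integral_of_le hτ]
    exact ((pinnedChain_integral_windowedCorrector_mul hω hl hβ hγ hN hT τ).2).symm
  exact tendsto_nhds_unique hlim1 hlim2

/-- **`⟨u, J⟩_{μ_T} = Z · ∫_{(0,∞)} c_N`** in the exact vocabulary of `CorrectorTheory`: for the
unnormalised Gibbs weight `μ_T = e^{-H/T} dq dp`, every `u ∈ L²(μ_T)` with `∫ (u_τ - u)² dμ_T → 0`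
(conjuncts A(2), A(4)) and `c_N ∈ L¹(0, ∞)` (conjunct B): `u J ∈ L¹(μ_T)` and
`∫ u J dμ_T = (∫ e^{-H/T} dq dp) · ∫_{(0,∞)} c_N(t) dt`. With the Green–Kubo identity of conjunct
B this is `⟨u, J⟩_{μ_T} = Z (N-1) T² D_N`. [folklore] -/
theorem pinnedChain_integral_corrector_mul_withDensity {u : PhaseSpace N → ℝ}
    (hu2 : MemLp u 2 (volume.withDensity (fun x : PhaseSpace N => ENNReal.ofReal (Real.exp
          (-((pinnedChain ω₂ lam β γ).hamiltonian N x) / T)))))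
    (h4 : Tendsto (fun τ : ℝ => ∫ x, ((∫ t in Ioc 0 τ, (∫ y, (∑ i : Fin N, (pinnedChain ω₂ lam β
          γ).bondCurrent N i y) ∂((pinnedChain ω₂ lam β γ).transitionKernel N T T (Real.toNNReal t)
          x))) - u x) ^ 2 ∂(volume.withDensity (fun x : PhaseSpace N => ENNReal.ofReal (Real.exp
          (-((pinnedChain ω₂ lam β γ).hamiltonian N x) / T))))) atTop (𝓝 0))
    (hc : IntegrableOn (fun t : ℝ => ∫ z, (∑ i : Fin N, (pinnedChain ω₂ lam β γ).bondCurrent N i z)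
          * (∫ y, (∑ i : Fin N, (pinnedChain ω₂ lam β γ).bondCurrent N i y) ∂((pinnedChain ω₂ lam β
          γ).transitionKernel N T T (Real.toNNReal t) z)) ∂((pinnedChain ω₂ lam β γ).gibbsMeasure N
          T)) (Ioi 0)) :
    Integrable (fun x => u x * (∑ i : Fin N, (pinnedChain ω₂ lam β γ).bondCurrent N i x))
          (volume.withDensity (fun x : PhaseSpace N => ENNReal.ofReal (Real.exp (-((pinnedChain ω₂
          lam β γ).hamiltonian N x) / T)))) ∧
      ∫ x, u x * (∑ i : Fin N, (pinnedChain ω₂ lam β γ).bondCurrent N i x) ∂(volume.withDensity (fun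
            x : PhaseSpace N => ENNReal.ofReal (Real.exp (-((pinnedChain ω₂ lam β γ).hamiltonian N
            x) / T)))) =
        (∫ x : PhaseSpace N, Real.exp (-((pinnedChain ω₂ lam β γ).hamiltonian N x) / T)) *
          ∫ t in Ioi 0, (∫ z, (∑ i : Fin N, (pinnedChain ω₂ lam β γ).bondCurrent N i z) * (∫ y, (∑ i
                : Fin N, (pinnedChain ω₂ lam β γ).bondCurrent N i y) ∂((pinnedChain ω₂ lam β
                γ).transitionKernel N T T (Real.toNNReal t) z)) ∂((pinnedChain ω₂ lam β
                γ).gibbsMeasure N T)) := by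
  have hint : Integrable ((pinnedChain ω₂ lam β γ).gibbsDensity N T) :=
    pinnedChain_integrable_gibbsDensity hω hl hβ.le γ N hT
  have hZ0 : (pinnedChain ω₂ lam β γ).partitionFunction N T ≠ 0 :=
    (pinnedChain ω₂ lam β γ).partitionFunction_ne_zero (pinnedChain_continuous_gibbsDensity ω₂ lam β
          γ N T)
  have hZt : (pinnedChain ω₂ lam β γ).partitionFunction N T ≠ ⊤ :=
    (pinnedChain ω₂ lam β γ).partitionFunction_ne_top hint
  have hμ : (volume.withDensity (fun x : PhaseSpace N => ENNReal.ofReal (Real.exp (-((pinnedChain ω₂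
        lam β γ).hamiltonian N x) / T)))) = (pinnedChain ω₂ lam β γ).partitionFunction N T •
        ((pinnedChain ω₂ lam β γ).gibbsMeasure N T) :=
    pinnedChain_withDensity_eq_smul_gibbsMeasure hω hl hT hβ.le
  -- transfer the hypotheses to `π`
  have hu2π : MemLp u 2 ((pinnedChain ω₂ lam β γ).gibbsMeasure N T) := by
    have h := hu2.smul_measure (ENNReal.inv_ne_top.2 hZ0)
    rwa [hμ, smul_smul, ENNReal.inv_mul_cancel hZ0 hZt, one_smul] at h
  have hZr : ((pinnedChain ω₂ lam β γ).partitionFunction N T).toReal =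
      ∫ x : PhaseSpace N, Real.exp (-((pinnedChain ω₂ lam β γ).hamiltonian N x) / T) := by
    rw [(pinnedChain ω₂ lam β γ).partitionFunction_eq_ofReal_integral hint,
      ENNReal.toReal_ofReal (integral_nonneg fun x => ((pinnedChain ω₂ lam β γ).gibbsDensity_pos N T
            x).le)]
    rfl
  have hZpos : 0 < ((pinnedChain ω₂ lam β γ).partitionFunction N T).toReal :=
    ENNReal.toReal_pos hZ0 hZt
  have h4π : Tendsto (fun τ : ℝ => ∫ x, ((∫ t in Ioc 0 τ, (∫ y, (∑ i : Fin N, (pinnedChain ω₂ lam β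
        γ).bondCurrent N i y) ∂((pinnedChain ω₂ lam β γ).transitionKernel N T T (Real.toNNReal t)
        x))) - u x) ^ 2 ∂((pinnedChain ω₂ lam β γ).gibbsMeasure N T)) atTop (𝓝 0) := by
    have h : Tendsto (fun τ : ℝ => ((pinnedChain ω₂ lam β γ).partitionFunction N T).toReal⁻¹ *
        ∫ x, ((∫ t in Ioc 0 τ, (∫ y, (∑ i : Fin N, (pinnedChain ω₂ lam β γ).bondCurrent N i y)
              ∂((pinnedChain ω₂ lam β γ).transitionKernel N T T (Real.toNNReal t) x))) - u x) ^ 2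
              ∂(volume.withDensity (fun x : PhaseSpace N => ENNReal.ofReal (Real.exp (-((pinnedChain
              ω₂ lam β γ).hamiltonian N x) / T))))) atTop (𝓝 0) := by
      simpa using h4.const_mul ((pinnedChain ω₂ lam β γ).partitionFunction N T).toReal⁻¹
    refine h.congr fun τ => ?_
    rw [hμ, integral_smul_measure, smul_eq_mul, ← mul_assoc, inv_mul_cancel₀ hZpos.ne', one_mul]
  obtain ⟨huJ, -⟩ := pinnedChain_tendsto_integral_windowedCorrector_mul hω hl hβ hγ hN hT hu2π h4π
  have heq := pinnedChain_integral_corrector_mul_gibbsMeasure hω hl hβ hγ hN hT hu2π h4π hc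
  refine ⟨?_, ?_⟩
  · rw [hμ]
    exact huJ.smul_measure hZt
  · rw [hμ, integral_smul_measure, smul_eq_mul, heq, hZr]

end Pairing

end Summit.AtomisticToContinuum.FouriersLaw.Theorems

end
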